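import Mathlib.LinearAlgebra.Matrix.Charpoly.Coeff
import Literature.NumberTheory.GaloisRepresentations.ArtinEulerFactorSpecProofs
import Literature.NumberTheory.GaloisRepresentations.ArtinLFunctionEulerFactorProofs
import Literature.NumberTheory.GaloisRepresentations.ModNCyclotomicCharacter
import HarnessLib

/-!
# Twists of framed representations by characters and their Euler factors (pure proofs)

Companion to `Literature.NumberTheory.GaloisRepresentations.ArtinLFunction` (Euler factors
`ArtinRep.eulerFactorAt`, `ArtinRep.eulerPolynomial`) and
`Literature.NumberTheory.GaloisRepresentations.ModNCyclotomicCharacter` (Dirichlet characters as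
Galois characters, `dirichletGaloisCharacter`).  It supplies the representation-theoretic input of
the analytic half of Booker's proof of his Lemma 1 (A. R. Booker, *Poles of Artin L-functions and
the strong Artin conjecture*, Ann. of Math. 158 (2003), p. 1093: "`∑ a_r χ(r) r^{-s}` is
`L(s, ρ ⊗ χ₀ ⊗ χ)`, with the Euler factor at `p` removed"), namely the computation of the Euler
factors of the **twist `ρ ⊗ χ`** of an Artin representation `ρ : Γ_K → GL_n(ℂ)` by a character
`χ : Γ_K → ℂˣ` at the places where `χ` is unramified:

  `L_v(ρ ⊗ χ, T) = L_v(ρ, χ(Frob_v) T)`,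

i.e. `det(1 - T (ρ ⊗ χ)(Frob_𝔓) | (V ⊗ χ)^{I_𝔓}) = det(1 - χ(Frob_𝔓) T ρ(Frob_𝔓) | V^{I_𝔓})`
since `I_𝔓` acts on `V ⊗ χ` through `ρ` alone (Neukirch, *Algebraic Number Theory*, VII §10,
(10.1) and the text before (10.2); Deligne–Serre, *Formes modulaires de poids 1*, Ann. Sci. ÉNS 7
(1974), 4.4, twisting Galois representations by Dirichlet characters "composé de `ε` et de
l'homomorphisme `G → (ℤ/Nℤ)^*`").

The twist is NOT introduced as a new definition: every statement quantifies over a framed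
representation `π` satisfying the pointwise identity
`hπ : ∀ g, π g = scalar (χ g) * ρ g` (Mathlib `Matrix.GeneralLinearGroup.scalar`), and
`FramedRep.exists_twist` constructs one (continuity of `g ↦ χ(g) · ρ(g)`; scalar matrices are
central, `Matrix.GeneralLinearGroup.scalar_commute`).  Contents:

* `Matrix.charpolyRev_smul'`, `LinearMap.reverse_charpoly_smul` — `det(1 - T·cA) = det(1 - (cT)·A)`:
  `(c • A).charpolyRev = A.charpolyRev.comp (C c * X)` (Mathlib `Matrix.charpolyRev`,
  `Matrix.reverse_charpoly`, `RingHom.map_det`), and its version for endomorphisms of a finite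
  free module;
* `FramedRep.exists_twist`, `FramedRep.toContinuousRep_apply_of_twist`
  (`(ρ ⊗ χ)(g) v = χ(g) • ρ(g) v`), `FramedRep.fixedSubmodule_eq_of_twist` (`(V ⊗ χ)^H = V^H`
  when `χ|_H = 1`), `FramedRep.isIrreducible_of_twist` (twisting preserves irreducibility: the
  invariant subspaces are the same);
* `FramedRep.eulerPolynomial_of_twist`, `FramedRep.eulerFactorAt_of_twist` — the displayed
  identity, for `χ` trivial on `I_𝔓` (`LinearEquiv.charpoly_conj` along `V^{I_𝔓} = (V ⊗ χ)^{I_𝔓}`,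
  then `reverse_charpoly_smul`; independence of the choices by
  `ArtinRep.eulerFactorAt_eq_eulerPolynomial`);
* `FramedRep.eulerFactorAt_of_twist_dirichlet` — over `K = ℚ`, for `χ = dirichletGaloisCharacter ℚ ε`
  with `ε` a Dirichlet character mod `N` (any level, possibly imprimitive) and a place `v` over a
  prime `p ∤ N`: `L_v(ρ ⊗ ε, T) = L_v(ρ, ε(p) T)` (`χ_N(I_𝔓) = 1`, `χ_N(Frob_𝔓) = p`:
  `modNCyclotomicCharacter_eq_one_of_mem_inertia`,
  `modNCyclotomicCharacter_eq_residueCard_of_isArithFrobAt`), and its evaluated form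
  `L_v(ρ ⊗ ε, z) = L_v(ρ, ε(p) z)`.

No definition, no named fact (D-0026); theorems only.

## References

* A. R. Booker, Ann. of Math. (2) 158 (2003), 1089–1098: proof of Lemma 1, p. 1093. [Booker2003]
* J. Neukirch, *Algebraic Number Theory* (1999), VII §10, (10.1) and before (10.2). [NeukirchANT1999]
* P. Deligne, J.-P. Serre, Ann. Sci. ÉNS (4) 7 (1974), 4.4. [DeligneSerreASENS1974]

## Mathlib / tree search

`lean search 'FramedRep.twist|twistByChar|exists_twist'`: nothing for framed representations
(the tree's `Representation.twist` of `Automorphic/MatrixCoefficients` is the algebraic twist of a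
Mathlib `Representation`; its `subrepresentationTwistOrderIso` is re-proved here in five lines to
avoid importing the smooth-representation cone).  Mathlib: `Matrix.GeneralLinearGroup.scalar`,
`scalar_commute`, `Matrix.charpolyRev`, `Matrix.reverse_charpoly`, `LinearEquiv.charpoly_conj`,
`LinearMap.charpoly_toMatrix`; no `charpolyRev_smul`.
-/

noncomputable section

open scoped NumberField
open Field IsDedekindDomain NumberField Module Polynomial

namespace Literature.NumberTheory.GaloisRepresentations

universe u

/-! ### `det(1 - T·cA) = det(1 - (cT)·A)` -/

section Charpoly

variable {R : Type*} [CommRing R] {ι : Type*} [Fintype ι] [DecidableEq ι]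

/-- **Scaling the matrix rescales the variable of the reversed characteristic polynomial**:
`det(1 - T (cA)) = det(1 - (cT) A)`, i.e. `(c • A).charpolyRev = A.charpolyRev ∘ (cX)`
(both sides are `det` of the same matrix `1 - cX · A` over `R[X]`; `RingHom.map_det` for the ring
homomorphism `P ↦ P ∘ (cX)`). [folklore] -/
theorem Matrix.charpolyRev_smul' (c : R) (A : Matrix ι ι R) :
    (c • A).charpolyRev = A.charpolyRev.comp (C c * X) := by
  rw [Matrix.charpolyRev, Matrix.charpolyRev, ← Polynomial.coe_compRingHom_apply, RingHom.map_det]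
  congr 1
  ext i j
  simp only [RingHom.mapMatrix_apply, Matrix.map_apply, Matrix.sub_apply, Matrix.smul_apply,
    Matrix.one_apply, smul_eq_mul, Polynomial.coe_compRingHom_apply]
  split_ifs with h
  · rw [Polynomial.sub_comp, Polynomial.mul_comp, Polynomial.one_comp, Polynomial.X_comp,
      Polynomial.C_comp, map_mul]
    ring
  · rw [Polynomial.sub_comp, Polynomial.mul_comp, Polynomial.zero_comp, Polynomial.X_comp,
      Polynomial.C_comp, map_mul]
    ring

/-- Endomorphism form of `charpolyRev_smul'`: for an endomorphism `f` of a finite free module and a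
scalar `c`, `det(1 - T (c f)) = det(1 - (cT) f)`, i.e.
`(c • f).charpoly.reverse = f.charpoly.reverse ∘ (cX)` (Mathlib `LinearMap.charpoly`,
`Matrix.reverse_charpoly`). [folklore] -/
theorem LinearMap.reverse_charpoly_smul {M : Type*} [AddCommGroup M] [Module R M] [Module.Free R M]
    [Module.Finite R M] (c : R) (f : Module.End R M) :
    (c • f).charpoly.reverse = f.charpoly.reverse.comp (C c * X) := by
  rw [LinearMap.charpoly_def, LinearMap.charpoly_def, map_smul, Matrix.reverse_charpoly,
    Matrix.reverse_charpoly, Matrix.charpolyRev_smul']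

end Charpoly

/-! ### Twists of framed representations by characters -/

namespace FramedRep

section Twist

variable {G : Type*} [Group G] [TopologicalSpace G] {A : Type*} [CommRing A] [TopologicalSpace A]
  [IsTopologicalRing A] {n : ℕ}

omit [IsTopologicalRing A] in
/-- The scalar embedding `Aˣ → GL_n(A)` is continuous. [folklore] -/
theorem continuous_generalLinearGroup_scalar :
    Continuous (Matrix.GeneralLinearGroup.scalar (Fin n) : Aˣ → GL (Fin n) A) := by
  refine Units.continuous_iff.2 ⟨?_, ?_⟩
  · change Continuous fun u : Aˣ => Matrix.scalar (Fin n) (u : A)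
    simp only [Matrix.scalar_apply]
    exact (continuous_pi fun _ => Units.continuous_val).matrix_diagonal
  · change Continuous fun u : Aˣ => Matrix.scalar (Fin n) ((u⁻¹ : Aˣ) : A)
    simp only [Matrix.scalar_apply]
    exact (continuous_pi fun _ => Units.continuous_coe_inv).matrix_diagonal

/-- **Existence of the twist `ρ ⊗ χ`**: for a framed representation `ρ : G →ₜ* GL_n(A)` and a
continuous character `χ : G →ₜ* Aˣ` there is a framed representation `π` with
`π(g) = χ(g) · ρ(g)` (scalar matrices are central, so this is a homomorphism; it is continuous as
a product of continuous maps).  Deligne–Serre 1974, 4.4 (twisting by "le composé de `ε` et de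
l'homomorphisme `G → (ℤ/Nℤ)^*`"). [folklore] -/
theorem exists_twist (ρ : FramedRep G A n) (χ : G →ₜ* Aˣ) :
    ∃ π : FramedRep G A n, ∀ g, π g = Matrix.GeneralLinearGroup.scalar (Fin n) (χ g) * ρ g := by
  refine ⟨{ toFun := fun g => Matrix.GeneralLinearGroup.scalar (Fin n) (χ g) * ρ g
            map_one' := by simp
            map_mul' := fun g h => ?_
            continuous_toFun :=
              (continuous_generalLinearGroup_scalar.comp χ.continuous_toFun).mul
                ρ.continuous_toFun }, fun g => rfl⟩
  rw [map_mul, map_mul, map_mul]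
  calc Matrix.GeneralLinearGroup.scalar (Fin n) (χ g) *
        Matrix.GeneralLinearGroup.scalar (Fin n) (χ h) * (ρ g * ρ h)
      = Matrix.GeneralLinearGroup.scalar (Fin n) (χ g) *
          (Matrix.GeneralLinearGroup.scalar (Fin n) (χ h) * ρ g) * ρ h := by
        simp only [mul_assoc]
    _ = Matrix.GeneralLinearGroup.scalar (Fin n) (χ g) *
          (ρ g * Matrix.GeneralLinearGroup.scalar (Fin n) (χ h)) * ρ h := by
        rw [Matrix.GeneralLinearGroup.scalar_commute (χ h) (ρ g)]
    _ = Matrix.GeneralLinearGroup.scalar (Fin n) (χ g) * ρ g *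
          (Matrix.GeneralLinearGroup.scalar (Fin n) (χ h) * ρ h) := by
        simp only [mul_assoc]

variable {ρ π : FramedRep G A n} {χ : G →ₜ* Aˣ}

/-- **The twist acts by `χ(g) • ρ(g)`**: if `π(g) = χ(g) · ρ(g)` then
`π(g) v = χ(g) • ρ(g) v` on `Aⁿ`. [folklore] -/
theorem toContinuousRep_apply_of_twist
    (hπ : ∀ g, π g = Matrix.GeneralLinearGroup.scalar (Fin n) (χ g) * ρ g) (g : G) (v : Fin n → A) :
    π.toContinuousRep g v = ((χ g : Aˣ) : A) • ρ.toContinuousRep g v := by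
  rw [FramedRep.toContinuousRep_apply_apply, FramedRep.toContinuousRep_apply_apply, hπ g,
    Units.val_mul, Matrix.GeneralLinearGroup.coe_scalar, Matrix.scalar_apply,
    ← Matrix.smul_eq_diagonal_mul, Matrix.smul_mulVec]

/-- The same as an identity of endomorphisms: `π(g) = χ(g) • ρ(g)` in `End(Aⁿ)`. [folklore] -/
theorem toContinuousRep_apply_eq_smul_of_twist
    (hπ : ∀ g, π g = Matrix.GeneralLinearGroup.scalar (Fin n) (χ g) * ρ g) (g : G) :
    (π.toContinuousRep g : Module.End A (Fin n → A)) = ((χ g : Aˣ) : A) • ρ.toContinuousRep g :=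
  LinearMap.ext fun v => toContinuousRep_apply_of_twist hπ g v

/-- **`(V ⊗ χ)^H = V^H` when `χ` is trivial on `H`** (the fixed vectors of a subgroup on which
the twisting character is trivial are the same for `ρ` and `ρ ⊗ χ`). [folklore] -/
theorem fixedSubmodule_eq_of_twist
    (hπ : ∀ g, π g = Matrix.GeneralLinearGroup.scalar (Fin n) (χ g) * ρ g) {H : Subgroup G}
    (hχ : ∀ h ∈ H, χ h = 1) :
    π.toContinuousRep.fixedSubmodule H = ρ.toContinuousRep.fixedSubmodule H := by
  ext v
  simp only [ContinuousRep.mem_fixedSubmodule]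
  refine forall₂_congr fun h hh => ?_
  rw [toContinuousRep_apply_of_twist hπ, hχ h hh, Units.val_one, one_smul]

end Twist

section Irreducible

variable {G : Type*} [Group G] [TopologicalSpace G] {k : Type*} [Field k] [TopologicalSpace k]
  [IsTopologicalRing k] {n : ℕ} {ρ π : FramedRep G k n} {χ : G →ₜ* kˣ}

/-- **Twisting by a character preserves irreducibility**: the subrepresentations of `ρ ⊗ χ`
and of `ρ` are the same subspaces (a subspace is stable under `χ(g) • ρ(g)` iff it is stable
under `ρ(g)`, `χ(g)` being a unit), so the two lattices of subrepresentations are isomorphic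
(the tree's `Representation.subrepresentationTwistOrderIso` of `Automorphic/IrreducibleClasses`,
re-proved inline for framed twists). [folklore] -/
theorem isIrreducible_of_twist
    (hπ : ∀ g, π g = Matrix.GeneralLinearGroup.scalar (Fin n) (χ g) * ρ g)
    (hρ : ρ.toContinuousRep.IsIrreducible) : π.toContinuousRep.IsIrreducible := by
  let e : Subrepresentation π.toContinuousRep.toRepresentation ≃o
      Subrepresentation ρ.toContinuousRep.toRepresentation :=
    { toFun := fun p => ⟨p.toSubmodule, fun g v hv => by
        have h := p.apply_mem_toSubmodule g hv
        change π.toContinuousRep g v ∈ p.toSubmodule at h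
        rw [toContinuousRep_apply_of_twist hπ, ← Units.smul_def] at h
        exact (Submodule.smul_mem_iff' _ (χ g)).1 h⟩
      invFun := fun q => ⟨q.toSubmodule, fun g v hv => by
        change π.toContinuousRep g v ∈ q.toSubmodule
        rw [toContinuousRep_apply_of_twist hπ]
        exact q.toSubmodule.smul_mem _ (q.apply_mem_toSubmodule g hv)⟩
      left_inv := fun p => by ext; rfl
      right_inv := fun q => by ext; rfl
      map_rel_iff' := Iff.rfl }
  exact e.isSimpleOrder_iff.mpr hρ

end Irreducible

/-! ### Euler factors of twists -/

section EulerFactor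

variable {K : Type u} [Field K] {n : ℕ} {ρ π : FramedArtinRep K n}
  {χ : absoluteGaloisGroup K →ₜ* ℂˣ}

/-- **The Euler polynomial of a twist**: if `π(g) = χ(g) · ρ(g)` and `χ` is trivial on the
inertia group `I_𝔓`, then for every `τ` in the decomposition group of `𝔓`,
`det(1 - T π(τ) | (ℂⁿ)^{I_𝔓, π}) = det(1 - χ(τ) T ρ(τ) | (ℂⁿ)^{I_𝔓, ρ})`, i.e.
`eulerPolynomial π 𝔓 τ = (eulerPolynomial ρ 𝔓 τ) ∘ (χ(τ) X)`.  The two spaces of inertia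
invariants coincide (`fixedSubmodule_eq_of_twist`), on them `π(τ) = χ(τ) • ρ(τ)`
(`LinearEquiv.charpoly_conj` along the identity `LinearEquiv.ofEq`), and
`det(1 - T (c f)) = det(1 - (cT) f)` (`LinearMap.reverse_charpoly_smul`).
[cite: NeukirchANT1999, VII §10, (10.1) and before (10.2)] -/
theorem eulerPolynomial_of_twist
    (hπ : ∀ g, π g = Matrix.GeneralLinearGroup.scalar (Fin n) (χ g) * ρ g)
    {𝔓 : Ideal (absIntegers (𝓞 K) K)}
    (hχ : ∀ h ∈ 𝔓.inertia (absoluteGaloisGroup K), χ h = 1)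
    (τ : 𝔓.decompositionSubgroup (absoluteGaloisGroup K)) :
    π.toArtinRep.eulerPolynomial 𝔓 τ =
      (ρ.toArtinRep.eulerPolynomial 𝔓 τ).comp (C ((χ τ : ℂˣ) : ℂ) * X) := by
  have heq : ρ.toArtinRep.fixedSubmodule (𝔓.inertia (absoluteGaloisGroup K)) =
      π.toArtinRep.fixedSubmodule (𝔓.inertia (absoluteGaloisGroup K)) :=
    (fixedSubmodule_eq_of_twist hπ hχ).symm
  set e := LinearEquiv.ofEq _ _ heq with he
  have hconj : e.conj (((χ τ : ℂˣ) : ℂ) • ρ.toArtinRep.restrictInertiaInvariants 𝔓 τ) =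
      π.toArtinRep.restrictInertiaInvariants 𝔓 τ := by
    refine LinearMap.ext fun w => Subtype.ext ?_
    rw [LinearEquiv.conj_apply_apply, ContinuousRep.restrictInertiaInvariants_apply,
      he, LinearEquiv.coe_ofEq_apply, LinearMap.smul_apply, Submodule.coe_smul,
      ContinuousRep.restrictInertiaInvariants_apply, LinearEquiv.ofEq_symm,
      LinearEquiv.coe_ofEq_apply]
    exact (toContinuousRep_apply_of_twist hπ (τ : absoluteGaloisGroup K) (w : Fin n → ℂ)).symm
  rw [ArtinRep.eulerPolynomial, ArtinRep.eulerPolynomial, ← hconj, LinearEquiv.charpoly_conj,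
    LinearMap.reverse_charpoly_smul]

variable [NumberField K]

/-- **The Euler factor of a twist at a place where the character is unramified**:
`L_v(ρ ⊗ χ, T) = L_v(ρ, χ(Frob_𝔓) T)` for any prime `𝔓 ∣ v` with `χ(I_𝔓) = 1` and any
arithmetic Frobenius `Frob_𝔓` (`ArtinRep.eulerFactorAt_eq_eulerPolynomial` on both sides, then
`eulerPolynomial_of_twist`).  Booker 2003, p. 1093 (Dirichlet coefficients of `L(s, ρ ⊗ χ₀ ⊗ χ)`
at integers prime to the level).
[cite: NeukirchANT1999, VII §10, (10.1) and before (10.2)] [cite: Booker2003, proof of Lemma 1 p. 1093] -/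
theorem eulerFactorAt_of_twist
    (hπ : ∀ g, π g = Matrix.GeneralLinearGroup.scalar (Fin n) (χ g) * ρ g)
    {v : HeightOneSpectrum (𝓞 K)} {𝔓 : Ideal (absIntegers (𝓞 K) K)} (h𝔓 : 𝔓 ∈ v.primesAbove)
    (hχ : ∀ h ∈ 𝔓.inertia (absoluteGaloisGroup K), χ h = 1) {Frob : absoluteGaloisGroup K}
    (hFrob : IsArithFrobAt (𝓞 K) Frob 𝔓) :
    π.toArtinRep.eulerFactorAt v =
      (ρ.toArtinRep.eulerFactorAt v).comp (C ((χ Frob : ℂˣ) : ℂ) * X) := by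
  rw [ArtinRep.eulerFactorAt_eq_eulerPolynomial π.toArtinRep h𝔓 hFrob,
    ArtinRep.eulerFactorAt_eq_eulerPolynomial ρ.toArtinRep h𝔓 hFrob]
  exact eulerPolynomial_of_twist hπ hχ _

end EulerFactor

/-! ### Twists by Dirichlet characters over `ℚ` -/

section Dirichlet

open Rat.HeightOneSpectrum

/-- `N v = p`: the residue field of the finite place `v` of `ℚ` over the prime `p` has `p`
elements (the tree's `Rat.residueCard_eq_natGenerator` of `HeckeCharacterProofs`, re-proved to
keep the imports of this file inside the Galois-representations topic). [folklore] -/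
theorem residueCard_eq_coe_primesEquiv' (v : HeightOneSpectrum (𝓞 ℚ)) :
    v.residueCard = ((primesEquiv v : Nat.Primes) : ℕ) := by
  rw [v.residueCard_eq_card_quotient]
  have h : Ideal.span {(natGenerator v : ℤ)} =
      v.asIdeal.map (Rat.IsIntegralClosure.intEquiv (𝓞 ℚ) : 𝓞 ℚ →+* ℤ) :=
    span_natGenerator v
  rw [Nat.card_congr ((Ideal.quotientEquiv _ _ (Rat.IsIntegralClosure.intEquiv (𝓞 ℚ)) h).trans
    (Int.quotientSpanNatEquivZMod _)).toEquiv, Nat.card_zmod]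
  rfl

variable {n N : ℕ} [NeZero N] {ρ π : FramedArtinRep ℚ n}

/-- The Galois character of a Dirichlet character mod `N` is trivial on the inertia groups of
the primes `𝔓` of `\bar ℤ` above a rational prime `p ∤ N` (`χ_N(I_𝔓) = 1`,
`modNCyclotomicCharacter_eq_one_of_mem_inertia`). [cite: NeukirchANT1999, Ch. I (10.3)–(10.4)] -/
theorem dirichletGaloisCharacter_eq_one_of_mem_inertia (ε : DirichletCharacter ℂ N)
    {v : HeightOneSpectrum (𝓞 ℚ)} {𝔓 : Ideal (absIntegers (𝓞 ℚ) ℚ)} (h𝔓 : 𝔓 ∈ v.primesAbove)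
    (hv : ¬ ((primesEquiv v : Nat.Primes) : ℕ) ∣ N) {h : absoluteGaloisGroup ℚ}
    (hh : h ∈ 𝔓.inertia (absoluteGaloisGroup ℚ)) :
    dirichletGaloisCharacter ℚ ε h = 1 := by
  haveI := h𝔓.1
  have hN := Rat.natCast_not_mem_of_mem_primesAbove_of_not_dvd h𝔓 hv
  have h1 : modNCyclotomicCharacter ℚ N h = 1 := modNCyclotomicCharacter_eq_one_of_mem_inertia hN hh
  change ε.toUnitHom (modNCyclotomicCharacter ℚ N h) = 1
  rw [h1, map_one]

/-- The Galois character of a Dirichlet character mod `N` takes the value `ε(p)` at the arithmetic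
Frobenii of the primes above `p ∤ N` (`χ_N(Frob_𝔓) = p`,
`modNCyclotomicCharacter_eq_residueCard_of_isArithFrobAt`; Artin's convention).
[cite: NeukirchANT1999, Ch. I (10.3) and VII §10 (10.4) (ii)] -/
theorem coe_dirichletGaloisCharacter_of_isArithFrobAt (ε : DirichletCharacter ℂ N)
    {v : HeightOneSpectrum (𝓞 ℚ)} {𝔓 : Ideal (absIntegers (𝓞 ℚ) ℚ)} (h𝔓 : 𝔓 ∈ v.primesAbove)
    (hv : ¬ ((primesEquiv v : Nat.Primes) : ℕ) ∣ N) {Frob : absoluteGaloisGroup ℚ}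
    (hFrob : IsArithFrobAt (𝓞 ℚ) Frob 𝔓) :
    ((dirichletGaloisCharacter ℚ ε Frob : ℂˣ) : ℂ) =
      ε (((primesEquiv v : Nat.Primes) : ℕ) : ZMod N) := by
  have hN := Rat.natCast_not_mem_of_mem_primesAbove_of_not_dvd h𝔓 hv
  rw [coe_dirichletGaloisCharacter_apply,
    modNCyclotomicCharacter_eq_residueCard_of_isArithFrobAt h𝔓 hN hFrob,
    residueCard_eq_coe_primesEquiv']

/-- **Euler factors of the twist of an Artin representation of `ℚ` by a Dirichlet character**
(Booker 2003, proof of Lemma 1, p. 1093; Neukirch VII (10.4) (ii) for the degree-one factor):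
if `π(g) = ε(χ_N(g)) · ρ(g)` for a Dirichlet character `ε` mod `N` (of any level, possibly
imprimitive), then at every place `v` of `ℚ` over a prime `p ∤ N`,
`L_v(π, T) = L_v(ρ, ε(p) T)`. [cite: Booker2003, proof of Lemma 1 p. 1093]
[cite: NeukirchANT1999, VII §10, (10.1) and (10.4) (ii)] -/
theorem eulerFactorAt_of_twist_dirichlet (ε : DirichletCharacter ℂ N)
    (hπ : ∀ g, π g = Matrix.GeneralLinearGroup.scalar (Fin n) (dirichletGaloisCharacter ℚ ε g) * ρ g)
    {v : HeightOneSpectrum (𝓞 ℚ)} (hv : ¬ ((primesEquiv v : Nat.Primes) : ℕ) ∣ N) :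
    π.toArtinRep.eulerFactorAt v =
      (ρ.toArtinRep.eulerFactorAt v).comp (C (ε (((primesEquiv v : Nat.Primes) : ℕ) : ZMod N)) * X) := by
  obtain ⟨⟨𝔓, Frob⟩, h𝔓, hFrob⟩ := ArtinRep.exists_mem_primesAbove_and_isArithFrobAt v
  rw [eulerFactorAt_of_twist hπ h𝔓
      (fun h hh => dirichletGaloisCharacter_eq_one_of_mem_inertia ε h𝔓 hv hh) hFrob,
    coe_dirichletGaloisCharacter_of_isArithFrobAt ε h𝔓 hv hFrob]

/-- Evaluated form of `eulerFactorAt_of_twist_dirichlet`: `L_v(π, z) = L_v(ρ, ε(p) z)` for every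
`z ∈ ℂ`. [cite: Booker2003, proof of Lemma 1 p. 1093] -/
theorem eval_eulerFactorAt_of_twist_dirichlet (ε : DirichletCharacter ℂ N)
    (hπ : ∀ g, π g = Matrix.GeneralLinearGroup.scalar (Fin n) (dirichletGaloisCharacter ℚ ε g) * ρ g)
    {v : HeightOneSpectrum (𝓞 ℚ)} (hv : ¬ ((primesEquiv v : Nat.Primes) : ℕ) ∣ N) (z : ℂ) :
    (π.toArtinRep.eulerFactorAt v).eval z =
      (ρ.toArtinRep.eulerFactorAt v).eval (ε (((primesEquiv v : Nat.Primes) : ℕ) : ZMod N) * z) := by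
  rw [eulerFactorAt_of_twist_dirichlet ε hπ hv, Polynomial.eval_comp, Polynomial.eval_mul,
    Polynomial.eval_C, Polynomial.eval_X]

end Dirichlet

end FramedRep

end Literature.NumberTheory.GaloisRepresentations

end
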